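import Literature.AlgebraicTopology.CharacteristicClasses.LineLocalIndexUnit
import Literature.AlgebraicTopology.SingularHomology.LocalDegreeLinearization
import Literature.AlgebraicTopology.SingularHomology.PositiveAtlasOrientation
import Literature.Topology.FourManifolds.IntersectionLatticeOrientationProofs
import Mathlib.Analysis.Complex.Basic
import HarnessLib

/-!
# The local index of a transverse zero of a section of a complex line bundle is the sign of its
# Jacobian (times a universal unit)

D. McDuff, D. Salamon, *Introduction to Symplectic Topology*, 3rd ed. (2017), §2.7, proof of
Thm. 2.7.5: for a section `s` of a complex line bundle over a closed oriented surface, transverse to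
the zero section, the contribution of a zero `p` to the first Chern number is the index `±1` of `p`,
the sign telling whether the linearisation `Ds(p) : T_pΣ → E_p` preserves or reverses orientation;
G. Bredon, *Topology and Geometry* (1993), VI.7, and J. Milnor, J. Stasheff, *Characteristic Classes*
(1974), Appendix A: the local degree of a `C¹` map with invertible Jacobian is the sign of the
Jacobian (the tree's `HomologicalOrientation.localDegree_of_hasFDerivAt`).

For the tree's local index `localIndex hF ℤ 1 s hs μ p` (`LineEulerNumberLocalization`: the relative
Kronecker pairing of the pulled-back relative Thom class with the local orientation `μ_p`) this file
proves, over a surface `B` (charts in `ℝ²`, Hausdorff):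

* `localIndex_eq_vecSection_of_subset` — the vector-model formula of `LineEulerNumberLocalModel` on
  ANY open `V ∋ p` inside `U_e ∩ U_p` (locality of the index);
* `lineToPlane : ℂ ≅ ℝ²` (`z ↦ (re z, im z)`), `planeGenerator g`, **`lineIndexUnit g`** — the INDEX
  UNIT `κ(g) := ⟨ω^rel_vec(1), γ_g⟩ ∈ ℤ` of an orientation `g` of `ℝ²` (`γ_g` = `g_0` carried to
  `H₂(ℂ, ℂ ∖ 0)`), with **`lineIndexUnit_eq_one_or_eq_neg_one : κ(g) = ±1`** (`LineLocalIndexUnit`);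
* `localRep` — the local representative `x ↦ (re, im) e_{c⁻¹ x}(s(c⁻¹ x)) : ℝ² → ℝ²` of `s` in an atlas
  trivialisation `e` and a chart `c`;
* **`localIndex_eq_sign_det_mul_lineIndexUnit`** — if `s p = 0`, `p` is an isolated zero, the
  `ℤ`-orientation `μ` of `B` at `p` is the transport of `g` through the chart `c`
  (`μ_p = (chartTransport c …)⁻¹ g_{c p}`, the DEFINING shape of the orientation attached to an
  oriented atlas, `HomologicalOrientationOfSmooth.localClassX`), and the local representative has an
  invertible derivative `A` at `c p`, then

    `ind_p(s) = sign(det A) · κ(g)`.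

  Proof: `ind_p(s) = ⟨ω^rel_vec, š_* μ_p|_V⟩` on `V = U_e ∩ U_p ∩ c.source` (`š` the section read in
  `e`); the square `š ∘ c⁻¹ = L⁻¹ ∘ t` (`t` the local representative, `L = lineToPlane`) and the
  naturality of the cross-universe transport (`relativeSingularHomology.xEquiv_map`) turn `š_* μ_p|_V`
  into `L⁻¹_* t_* (g_{c p}|_{c(V)})`, and `t_* (g_{c p}|) = sign(det A) g_0` by the local degree theorem.

Everything is proved; no named facts.

## References

* [McDuffSalamon2017] D. McDuff, D. Salamon, Introduction to Symplectic Topology, 3rd ed., OUP 2017,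
  §2.7 Thm. 2.7.5 (proof).
* [Bredon1993] G. E. Bredon, Topology and Geometry, GTM 139, Springer 1993, VI.7.
* [MilnorStasheff1974] J. Milnor, J. Stasheff, Characteristic Classes, PUP 1974, §9 Thm. 9.1, App. A.
* [HatcherAT2002] A. Hatcher, Algebraic Topology, CUP 2002, Thm. 2.20, §3.3 pp. 231–236.
-/

noncomputable section

open CategoryTheory Limits Function Set Bundle Topology Literature.AlgebraicTopology.SingularHomology
  Literature.Topology.FourManifolds.HomologicalOrientationOfSmooth
open scoped LinearAlgebra.Projectivization

/-- Local notation: `𝔼 n` is the model Euclidean space `EuclideanSpace ℝ (Fin n)`. -/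
local notation "𝔼 " n:arg => EuclideanSpace ℝ (Fin n)

universe u

namespace Literature.AlgebraicTopology.CharacteristicClasses

/-! ### The local index through the vector model, on any small open set -/

section AnyOpen

variable {B : Type u} [TopologicalSpace B] (F : Type u) [NormedAddCommGroup F] [NormedSpace ℂ F] [FiniteDimensional ℂ F]
  (E : B → Type u) [∀ b, AddCommGroup (E b)] [∀ b, Module ℂ (E b)]
  [TopologicalSpace (TotalSpace F E)] [∀ b, TopologicalSpace (E b)] [FiberBundle F E] [VectorBundle ℂ F E]
  (hF : Module.finrank ℂ F = 1) (R : Type u) [CommRing R]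
  (m : R) (s : ∀ b, E b) (hs : Continuous fun b ↦ (⟨b, s b⟩ : TotalSpace F E))

variable {F E}

/-- **The local index through the vector model, computed on ANY open `V ∋ p` inside `U_e ∩ U_p`**:
`ind_p(s) = ⟨ω^rel_vec, (b ↦ e_b(s b))_* μ_p|_V⟩` (locality of the index, `localIndex_eq_of_subset`,
and the identification of the relative Thom class over `U_e` with the model class,
`relThomClassOn_eq_model`). [cite: McDuffSalamon2017, Thm. 2.7.5] -/
theorem localIndex_eq_vecSection_of_subset [T2Space B] [ParacompactSpace B] (e : Trivialization F (π F E))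
    [MemTrivializationAtlas e] (μ : HomologicalOrientation R B 2) (p : B) (hU : IsOpen (indexDomain s p))
    {V : Set B} (hV : IsOpen V) (hpV : p ∈ V) (hVe : V ⊆ e.baseSet) (hVU : V ⊆ indexDomain s p) :
    localIndex hF R m s hs μ p =
      relKroneckerM R (ULift.{u} ℂ) ({0}ᶜ : Set (ULift.{u} ℂ)) 2 (omegaRelVec (ULift.{u} ℂ) finrank_model R R m)
        (relativeSingularHomology.map R R (vecSection hF s hs e hVe) (mapsTo_vecSection hF s hs e hVe hpV hVU) 2
          ((localHomology.openSubsetIso R R hV hpV 2).inv (μ.localClass p))) := by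
  have hmaps : MapsTo (projSectionOn s hs hVe) ({(⟨p, hpV⟩ : ↥V)}ᶜ : Set ↥V) (vectorPartOn e.baseSet) :=
    fun b hb ↦ mapsTo_projSection_of_subset s hs hpV hVU hb
  have hfac : relSingularCohomology.map R R ((projSection s hs).comp (subsetIncl V))
      (mapsTo_projSection_of_subset s hs hpV hVU) 2 (relThomClass F E hF R m) =
      relSingularCohomology.map R R (projSectionOn s hs hVe) hmaps 2 (relThomClassOn hF R e.baseSet m) := by
    rw [relThomClassOn, ← ModuleCat.comp_apply, ← relSingularCohomology.map_comp,
      relSingularCohomology.map_congr (subsetIncl_comp_projSectionOn s hs hVe) _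
        (mapsTo_projSection_of_subset s hs hpV hVU) 2]
  rw [localIndex_eq_of_subset hF R m s hs μ p hU hV hpV hVU, hfac, relThomClassOn_eq_model hF R e subset_rfl m,
    modelRelThomClassOn, ← ModuleCat.comp_apply, ← relSingularCohomology.map_comp, ← relKroneckerM_map, omegaRelVec,
    ← ModuleCat.comp_apply, ← relSingularCohomology.map_comp,
    relSingularCohomology.map_congr (vecEmbed_comp_vecSection hF s hs e hVe) _
      (mapsTo_modelSection hF s hs e hVe hpV hVU) 2]
  rfl

end AnyOpen

/-! ### The plane model of the line and the index unit -/

section Plane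

/-- **The fixed real-linear identification `ℂ ≅ ℝ²`, `z ↦ (re z, im z)`**, of the model line with
the model plane of surface charts. [folklore] -/
def lineToPlane : ULift.{0} ℂ ≃L[ℝ] 𝔼 2 :=
  (ContinuousLinearEquiv.ulift : ULift.{0} ℂ ≃L[ℝ] ℂ).trans (Complex.equivRealProdCLM.trans
    ((ContinuousLinearEquiv.finTwoArrow ℝ ℝ).symm.trans (EuclideanSpace.equiv (Fin 2) ℝ).symm))

/-- `lineToPlane z = ![re z, im z]`. [folklore] -/
theorem lineToPlane_apply (z : ULift.{0} ℂ) (i : Fin 2) :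
    lineToPlane z i = ![z.down.re, z.down.im] i := by
  fin_cases i <;> rfl

/-- The plane-to-line homeomorphism `ℝ² ≅ ℂ`. [folklore] -/
abbrev planeToLine : 𝔼 2 ≃ₜ ULift.{0} ℂ := lineToPlane.symm.toHomeomorph

/-- `planeToLine` is a map of pairs `(ℝ², ℝ² ∖ 0) → (ℂ, ℂ ∖ 0)`. [folklore] -/
theorem mapsTo_planeToLine : MapsTo planeToLine ({0}ᶜ : Set (𝔼 2)) ({0}ᶜ : Set (ULift.{0} ℂ)) := by
  intro v hv h0
  exact hv (by simpa using congrArg lineToPlane h0)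

/-- `planeToLine⁻¹` is a map of pairs `(ℂ, ℂ ∖ 0) → (ℝ², ℝ² ∖ 0)`. [folklore] -/
theorem mapsTo_planeToLine_symm : MapsTo planeToLine.symm ({0}ᶜ : Set (ULift.{0} ℂ)) ({0}ᶜ : Set (𝔼 2)) := by
  intro z hz h0
  exact hz (by simpa using congrArg lineToPlane.symm h0)

/-- **The transported local orientation generator** `γ_g ∈ H₂(ℂ, ℂ ∖ 0; ℤ)` of an orientation `g` of
the plane: `g_0` carried along `ℝ² ≅ ℂ`. [folklore] -/
def planeGenerator (g : HomologicalOrientation ℤ (𝔼 2) 2) :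
    relativeSingularHomology ℤ ℤ (ULift.{0} ℂ) ({0}ᶜ : Set (ULift.{0} ℂ)) 2 :=
  relativeSingularHomology.xEquiv ℤ ℤ planeToLine mapsTo_planeToLine mapsTo_planeToLine_symm 2 (g.localClass 0)

/-- `γ_g` generates `H₂(ℂ, ℂ ∖ 0; ℤ)`. [folklore] -/
theorem isGenerator_planeGenerator (g : HomologicalOrientation ℤ (𝔼 2) 2) :
    ∃ e : relativeSingularHomology ℤ ℤ (ULift.{0} ℂ) ({0}ᶜ : Set (ULift.{0} ℂ)) 2 ≃ₗ[ℤ] ℤ, e (planeGenerator g) = 1 :=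
  exists_linearEquiv_apply_eq_one_of_linearEquiv _ (g.isGenerator 0)

/-- **The index unit `κ(g) := ⟨ω^rel_vec(1), γ_g⟩ ∈ ℤ`** of an orientation `g` of the plane: the
value of the tree's preferred relative generator on the transported orientation generator.
[cite: MilnorStasheff1974, §9 Thm. 9.1] -/
def lineIndexUnit (g : HomologicalOrientation ℤ (𝔼 2) 2) : ℤ :=
  relKroneckerM ℤ (ULift.{0} ℂ) ({0}ᶜ : Set (ULift.{0} ℂ)) 2 (omegaRelVec (ULift.{0} ℂ) finrank_model ℤ ℤ 1)
    (planeGenerator g)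

/-- **`κ(g) = ±1`.** [cite: MilnorStasheff1974, §9 Thm. 9.1] -/
theorem lineIndexUnit_eq_one_or_eq_neg_one (g : HomologicalOrientation ℤ (𝔼 2) 2) :
    lineIndexUnit g = 1 ∨ lineIndexUnit g = -1 :=
  relKroneckerM_omegaRelVec_eq_one_or_eq_neg_one (ULift.{0} ℂ) finrank_model (isGenerator_planeGenerator g)

/-- `κ(g)² = 1`, `|κ(g)| = 1`. [folklore] -/
theorem lineIndexUnit_mul_self (g : HomologicalOrientation ℤ (𝔼 2) 2) : lineIndexUnit g * lineIndexUnit g = 1 := by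
  rcases lineIndexUnit_eq_one_or_eq_neg_one g with h | h <;> rw [h] <;> norm_num

end Plane

/-! ### The local index of a zero with non-degenerate linearisation -/

section Degree

variable {B : Type} [TopologicalSpace B] [T2Space B] (F : Type) [NormedAddCommGroup F] [NormedSpace ℂ F]
  [FiniteDimensional ℂ F] (E : B → Type) [∀ b, AddCommGroup (E b)] [∀ b, Module ℂ (E b)]
  [TopologicalSpace (TotalSpace F E)] [∀ b, TopologicalSpace (E b)] [FiberBundle F E] [VectorBundle ℂ F E]
  (hF : Module.finrank ℂ F = 1)
  (s : ∀ b, E b) (hs : Continuous fun b ↦ (⟨b, s b⟩ : TotalSpace F E))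

variable {F E}

/-- **The local representative of a section** in an atlas trivialisation `e` and a chart `c` of the
base, read in the plane: `x ↦ (re, im) e_{c⁻¹ x}(s (c⁻¹ x)) : ℝ² → ℝ²` (junk off `c.target`).
[cite: McDuffSalamon2017, Thm. 2.7.5] -/
def localRep (e : Trivialization F (π F E)) (c : OpenPartialHomeomorph B (𝔼 2)) (x : 𝔼 2) : 𝔼 2 :=
  lineToPlane (stdEquiv F hF (e ⟨c.symm x, s (c.symm x)⟩).2)

/-- **The local index of a zero with non-degenerate linearisation is the sign of the Jacobian times
the index unit.**  Let `p` be an isolated zero of the continuous section `s` of the complex line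
bundle `λ` over the surface `B`, `e ∋ p` an atlas trivialisation, `c ∋ p` a chart of `B` in `ℝ²`
through which the `ℤ`-orientation `μ` of `B` at `p` is the transport of an orientation `g` of `ℝ²`
(as for the orientation attached to an oriented atlas), and suppose the local representative
`x ↦ e_{c⁻¹x}(s(c⁻¹ x)) ∈ ℂ = ℝ²` is differentiable at `c p` with invertible derivative `A`.  Then

  `ind_p(s) = sign(det A) · κ(g)`,  `κ(g) = ±1`

(McDuff–Salamon 2017, proof of Thm. 2.7.5: the index of a transverse zero is `±1` according to the
orientation behaviour of `Ds(p)`; Milnor–Stasheff App. A / Bredon VI.7: the local degree of a `C¹`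
map is the sign of its Jacobian, the tree's `localDegree_of_hasFDerivAt`).
[cite: McDuffSalamon2017, Thm. 2.7.5] [cite: Bredon1993, VI.7] -/
theorem localIndex_eq_sign_det_mul_lineIndexUnit [ParacompactSpace B] (e : Trivialization F (π F E))
    [MemTrivializationAtlas e] (μ : HomologicalOrientation ℤ B 2) (p : B) (hsp : s p = 0)
    (hU : IsOpen (indexDomain s p)) (hp : p ∈ e.baseSet) (g : HomologicalOrientation ℤ (𝔼 2) 2)
    (c : OpenPartialHomeomorph B (𝔼 2)) (hpc : p ∈ c.source)
    (hμ : μ.localClass p = (chartTransport c c.open_source subset_rfl hpc 2).symm (g.localClass (c p)))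
    {A : (𝔼 2) →L[ℝ] 𝔼 2} (ht : HasFDerivAt (localRep hF s e c) A (c p))
    (hA : LinearMap.det (A : (𝔼 2) →ₗ[ℝ] 𝔼 2) ≠ 0) :
    localIndex hF ℤ 1 s hs μ p =
      (if 0 < LinearMap.det (A : (𝔼 2) →ₗ[ℝ] 𝔼 2) then 1 else -1) * lineIndexUnit g := by
  -- the open set `V = U_e ∩ U_p ∩ c.source ∋ p` and its image `W = c(V)`
  set V : Set B := e.baseSet ∩ indexDomain s p ∩ c.source with hVdef
  have hV : IsOpen V := (e.open_baseSet.inter hU).inter c.open_source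
  have hpV : p ∈ V := ⟨⟨hp, mem_indexDomain_self s p⟩, hpc⟩
  have hVe : V ⊆ e.baseSet := fun b hb ↦ hb.1.1
  have hVU : V ⊆ indexDomain s p := fun b hb ↦ hb.1.2
  have hVc : V ⊆ c.source := fun b hb ↦ hb.2
  have hW : IsOpen (c '' V) := c.isOpen_image_of_subset_source hV hVc
  have hcpW : c p ∈ c '' V := mem_image_of_mem c hpV
  have hWt : c '' V ⊆ c.target := fun x hx ↦ by
    obtain ⟨b, hb, rfl⟩ := hx
    exact c.map_source (hVc hb)
  have hsymm : ∀ x ∈ c '' V, c.symm x ∈ V := by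
    rintro _ ⟨b, hb, rfl⟩
    rwa [c.left_inv (hVc hb)]
  rw [localIndex_eq_vecSection_of_subset hF ℤ 1 s hs e μ p hU hV hpV hVe hVU]
  -- the model map `t = localRep|_W : (W, W ∖ c p) → (ℝ², ℝ² ∖ 0)`
  have hcont : ContinuousOn (fun b ↦ stdEquiv F hF (e ⟨b, s b⟩).2) e.baseSet :=
    continuousOn_iff_continuous_restrict.2 (vecSection hF s hs e (subset_rfl : e.baseSet ⊆ e.baseSet)).continuous
  have htc : ContinuousOn (localRep hF s e c) (c '' V) :=
    lineToPlane.continuous.comp_continuousOn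
      (hcont.comp (c.continuousOn_symm.mono hWt) fun x hx ↦ hVe (hsymm x hx))
  have ht0 : localRep hF s e c (c p) = 0 := by
    unfold localRep
    rw [c.left_inv hpc, hsp, ← linEquivAt_apply (K := ℂ) e hp, map_zero, map_zero, map_zero]
  have hmapsW : MapsTo (fun w : ↥(c '' V) ↦ localRep hF s e c w) ({(⟨c p, hcpW⟩ : ↥(c '' V))}ᶜ : Set _)
      ({0}ᶜ : Set (𝔼 2)) := by
    intro w hw h0
    change localRep hF s e c w = 0 at h0
    have hb : c.symm w ∈ V := hsymm w w.2
    have hbp : (c.symm w : B) ≠ p := by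
      intro hbp
      apply hw
      apply Subtype.ext
      change (w : 𝔼 2) = c p
      rw [← hbp, c.right_inv (hWt w.2)]
    apply (hVU hb).resolve_left hbp
    unfold localRep at h0
    rw [ContinuousLinearEquiv.map_eq_zero_iff, ContinuousLinearEquiv.map_eq_zero_iff,
      ← linEquivAt_apply (K := ℂ) e (hVe hb), ContinuousLinearEquiv.map_eq_zero_iff] at h0
    exact h0
  have hdeg := g.localDegree_of_hasFDerivAt (localRep hF s e c) hW hcpW htc ht hA ht0 hmapsW
  -- the homeomorphism of pairs `ψ = c⁻¹ : (W, W ∖ c p) ≅ (V, V ∖ p)` and the square `š ∘ ψ = L⁻¹ ∘ t`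
  set φ := chartHomeo c hVc with hφ
  have hφp : φ ⟨p, hpV⟩ = ⟨c p, hcpW⟩ := rfl
  have hAB : MapsTo φ.symm ({(⟨c p, hcpW⟩ : ↥(c '' V))}ᶜ : Set _) ({(⟨p, hpV⟩ : ↥V)}ᶜ : Set ↥V) := by
    intro w hw h
    apply hw
    rw [mem_singleton_iff] at h ⊢
    rw [← φ.apply_symm_apply w, h, hφp]
  have hBA : MapsTo φ.symm.symm ({(⟨p, hpV⟩ : ↥V)}ᶜ : Set ↥V) ({(⟨c p, hcpW⟩ : ↥(c '' V))}ᶜ : Set _) := by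
    intro b hb h
    apply hb
    rw [mem_singleton_iff] at h ⊢
    rw [Homeomorph.symm_symm, ← hφp] at h
    exact φ.injective h
  have hsq : ∀ w : ↥(c '' V), (vecSection hF s hs e hVe) (φ.symm w) =
      planeToLine ((⟨fun v : ↥(c '' V) ↦ localRep hF s e c v, htc.restrict⟩ : C(↥(c '' V), 𝔼 2)) w) := by
    intro w
    change stdEquiv F hF (e ⟨c.symm w, s (c.symm w)⟩).2 = lineToPlane.symm (lineToPlane _)
    rw [ContinuousLinearEquiv.symm_apply_apply]
  have key := relativeSingularHomology.xEquiv_map ℤ ℤ φ.symm planeToLine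
    (⟨fun v : ↥(c '' V) ↦ localRep hF s e c v, htc.restrict⟩ : C(↥(c '' V), 𝔼 2)) (vecSection hF s hs e hVe) hsq
    hAB hBA mapsTo_planeToLine mapsTo_planeToLine_symm hmapsW (mapsTo_vecSection hF s hs e hVe hpV hVU) 2
    ((localHomology.openSubsetIso ℤ ℤ hW hcpW 2).inv (g.localClass (c p)))
  -- the transported class on `(V, V ∖ p)` is the local orientation `μ_p`
  have hT : chartTransport c hV hVc hpV 2 = chartTransport c c.open_source subset_rfl hpc 2 :=
    LinearEquiv.ext fun z ↦ chartTransport_mono c hV c.open_source hVc subset_rfl hpV 2 z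
  have hμ' : μ.localClass p = (chartTransport c hV hVc hpV 2).symm (g.localClass (c p)) := by
    rw [hT]
    exact hμ
  have h1 : (localHomology.openSubsetIso ℤ ℤ hV hpV 2).inv (μ.localClass p) =
      (localHomology.xEquiv ℤ ℤ φ ⟨p, hpV⟩ 2).symm
        ((localHomology.openSubsetIso ℤ ℤ (c.isOpen_image_of_subset_source hV hVc) (mem_image_of_mem c hpV) 2).inv
          (g.localClass (c p))) := by
    rw [hμ', chartTransport_symm_apply]
    exact Iso.hom_inv_id_apply (localHomology.openSubsetIso ℤ ℤ hV hpV 2) _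
  have hclass : relativeSingularHomology.xEquiv ℤ ℤ φ.symm hAB hBA 2
      ((localHomology.openSubsetIso ℤ ℤ hW hcpW 2).inv (g.localClass (c p))) =
      (localHomology.openSubsetIso ℤ ℤ hV hpV 2).inv (μ.localClass p) := by
    rw [h1]
    exact (relativeSingularHomology.xEquiv_symm_apply ℤ ℤ φ (mapsTo_compl_singleton φ.toEquiv ⟨p, hpV⟩)
      (mapsTo_symm_compl_singleton φ.toEquiv ⟨p, hpV⟩) hBA 2 _).symm
  rw [hclass] at key
  rw [← key, hdeg]
  split_ifs with hdet
  · rw [one_mul]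
    rfl
  · rw [map_neg, map_neg, neg_one_mul]
    rfl

end Degree

end Literature.AlgebraicTopology.CharacteristicClasses
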